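import Literature.Computability.AlgebraicComplexity.MoreAsymHashedZeroOut
import Literature.Computability.AlgebraicComplexity.MoreAsymmetricCleanupGeneral
import Literature.Computability.AlgebraicComplexity.HashedZeroOutHoles
import HarnessLib

/-!
# The `Y`- and `Z`-holes of a more asymmetric hashed stage: Claim 5.20 / Claim 6.21, Markov's inequality
and the existence of a good seed, in abstract form
(Alman–Duan–Vassilevska Williams–Xu–Xu–Zhou 2025, §5.5 and §6.5–§6.6) — proved

Topic `Literature/Computability/AlgebraicComplexity`.  §6.5 of Alman–Duan–Vassilevska Williams–Xu–Xu–
Zhou, *More asymmetry yields faster matrix multiplication* (SODA 2025, arXiv:2404.16349) repeats for the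
constituent stage the probabilistic treatment of the holes of §5.5: the level-1 `Y`-blocks `Y`-compatible
with several triples of `𝒯_hash` and the level-1 `Z`-blocks compatible with several triples are zeroed out and
become holes; their expected number is bounded by the union bound over the competing triples (each in the
bucket of `T` with conditional probability `1/M`, Lemma 5.5 / 6.7 (1)), the final constraints on `M₀`, and
Markov's inequality ("with constant probability … the fraction of holes is `≤ 1/8N` in all three
dimensions").  The tree's `MoreAsymmetricHoles.lean` proves this for the §5 data and `HashedZeroOutHoles.lean`
proves VXXZ's one-dimensional version abstractly; this file PROVES the two-dimensional version once for an
arbitrary more asymmetric hashed stage `S : MoreAsymHashedZeroOut c N M` (`MoreAsymHashedZeroOut.lean`) whose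
universe is a family of level triples with bounded `X`-degree (`MoreAsymmetricCleanupGeneral.lean`), as exact
counts over the seed space, and directly in the "relevant holes" form of §6.6 (holes inside given sets
`A_Y`, `A_Z` of level-1 sequences — e.g. those appearing in the input; the others are holes of the first kind
anyway):

* `holePairsYIn A_Y T`, `holePairsZIn A_Z T`, `holeY_subset`, `holeZ_subset` — a hole witnesses a pair
  `(Ĵ, T')` (resp. `(K̂, T')`), `T' ∈ 𝒯α ∖ {T}` through `Y_J` (resp. `Z_K`) compatible with it, with `T'` in
  the bucket of `T`;
* `sum_card_holesYIn_le`, `sum_card_holesZIn_le` — **Claim 5.20 / 6.21 summed**: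
  `∑_ω |holesY_ω T ∩ A_Y| ≤ U_Y(T) · M^{N−1}` and likewise for `Z`;
* `card_seeds_manyHolesYIn_mul_succ_le`, `…ZIn…` — **Markov**;
* `card_seeds_goodIn_ge` — with Lemma 6.7 (2) (`advxxz2025_lemma67_survival`, `7/8`): under
  `8 deg_X ≤ M` on `𝒯α` and `10 · U_W(T) · M^{N−1} ≤ (h_W+1) · M^N` (`W = Y, Z`), at least half of the
  `M^N` seeds of a bucket `b ∈ B` make `T` a triple of `𝒯_hash` with at most `h_Y` relevant `Y`-holes and at
  most `h_Z` relevant `Z`-holes;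
* `exists_seed_many_goodIn_copies` — **some seed makes at least `|B| |𝒯α| / (2M²)` triples of `𝒯_hash`
  good.**

Everything is proved; the definitions are the hole-pair sets; no named facts.

## References

* J. Alman, R. Duan, V. Vassilevska Williams, Y. Xu, Z. Xu, R. Zhou, *More asymmetry yields faster
  matrix multiplication*, SODA 2025, arXiv:2404.16349 (held: `paper:arxiv-2404.16349`, chunks p0020,
  p0025–p0026): Claim 5.20 and the union-bound paragraph of §5.5, Claim 6.21 and §6.5–§6.6 (the constraints
  on `M₀`, "with constant probability"). [AlmanDuanVassilevskaWilliamsXuXuZhou2025]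
* V. Vassilevska Williams, Y. Xu, Z. Xu, R. Zhou, *New bounds for matrix multiplication: from alpha
  to omega*, SODA 2024, arXiv:2307.07970, Claims 5.16, 6.15 (the one-dimensional originals).
  [VassilevskaWilliamsXuXuZhou2024]
-/

noncomputable section

open scoped BigOperators
open Finset

namespace Literature.Computability.AlgebraicComplexity

namespace MoreAsymHashedZeroOut

open scoped Classical

variable {c N M : ℕ} (S : MoreAsymHashedZeroOut c N M)

/-- **The pairs `(Ĵ, T')` behind the `Y`-holes of the copy over `T` with `Ĵ ∈ A_Y`**: `Ĵ ∈ Y_J` useful for `T`,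
and `T' ∈ 𝒯α`, `T' ≠ T`, through the same `Y_J`, `Y`-compatible with `Ĵ` (their number `U_Y(T)` is the printed
`∑_{Ĵ} (numalpha/numyblock) · p_compY`). [cite: AlmanDuanVassilevskaWilliamsXuXuZhou2025, Claim 5.20 (second part) / Claim 6.21] -/
def holePairsYIn (A : Finset (Fin N → Fin c → Fin 3)) (T : (Fin N → Fin (2 * c + 1)) × (Fin N → Fin (2 * c + 1)) × (Fin N → Fin (2 * c + 1))) :
    Finset ((Fin N → Fin c → Fin 3) × ((Fin N → Fin (2 * c + 1)) × (Fin N → Fin (2 * c + 1)) × (Fin N → Fin (2 * c + 1)))) :=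
  (A ×ˢ S.𝒯α).filter fun p => blockOfSeq p.1 = T.2.1 ∧ S.UY T p.1 ∧ p.2 ≠ T ∧ p.2.2.1 = T.2.1 ∧ S.CY p.2 p.1

/-- **The pairs `(K̂, T')` behind the `Z`-holes of the copy over `T` with `K̂ ∈ A_Z`.** [cite: AlmanDuanVassilevskaWilliamsXuXuZhou2025, Claim 5.20 (first part) / Claim 6.21] -/
def holePairsZIn (A : Finset (Fin N → Fin c → Fin 3)) (T : (Fin N → Fin (2 * c + 1)) × (Fin N → Fin (2 * c + 1)) × (Fin N → Fin (2 * c + 1))) :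
    Finset ((Fin N → Fin c → Fin 3) × ((Fin N → Fin (2 * c + 1)) × (Fin N → Fin (2 * c + 1)) × (Fin N → Fin (2 * c + 1)))) :=
  (A ×ˢ S.𝒯α).filter fun p => blockOfSeq p.1 = T.2.2 ∧ S.UZ T p.1 ∧ p.2 ≠ T ∧ p.2.2.2 = T.2.2 ∧ S.CZ p.2 p.1

variable {S} [Fact M.Prime]

/-- **A relevant `Y`-hole witnesses a `Y`-compatible triple in the same bucket** (triples of `𝒯_hash` are
hash-present, hence in one bucket, and the two share `Y_J`). [cite: AlmanDuanVassilevskaWilliamsXuXuZhou2025, Claim 5.20 (second part) / Claim 6.21] -/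
theorem holeY_subset (h𝒯 : IsLevelFamily (2 * c) S.𝒯) (hM : M ≠ 2) (hB : ThreeAPFree (S.B : Set (ZMod M))) {ω : VxxzSeed M N}
    {T : (Fin N → Fin (2 * c + 1)) × (Fin N → Fin (2 * c + 1)) × (Fin N → Fin (2 * c + 1))}
    (hT : T ∈ S.present ω) {A : Finset (Fin N → Fin c → Fin 3)} {Jh : Fin N → Fin c → Fin 3}
    (hJ : Jh ∈ S.holesY ω T ∩ A) :
    ∃ T', (Jh, T') ∈ S.holePairsYIn A T ∧ InBucket (2 * c) ω T' (vxxzHashX ω (seqVal T.1)) := by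
  obtain ⟨hJ, hJA⟩ := mem_inter.1 hJ
  rw [holesY, mem_filter] at hJ
  obtain ⟨-, hblk, hu, T', hT'p, hne, hJ', hc⟩ := hJ
  refine ⟨T', mem_filter.2 ⟨mem_product.2 ⟨hJA, xPresentTriples_subset hT'p⟩, hblk, hu, hne, hJ', hc⟩, ?_⟩
  have hTb := h𝒯.inBucket_of_mem_hashPresent hM hB (hashPresent_of_mem_xPresentTriples hT)
  have hT'b := h𝒯.inBucket_of_mem_hashPresent hM hB (hashPresent_of_mem_xPresentTriples hT'p)
  have e : vxxzHashX ω (seqVal T'.1) = vxxzHashX ω (seqVal T.1) := by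
    rw [← hT'b.2.1, ← hTb.2.1, hJ']
  rwa [e] at hT'b

/-- **A relevant `Z`-hole witnesses a compatible triple in the same bucket.** [cite: AlmanDuanVassilevskaWilliamsXuXuZhou2025, Claim 5.20 (first part) / Claim 6.21] -/
theorem holeZ_subset (h𝒯 : IsLevelFamily (2 * c) S.𝒯) (hM : M ≠ 2) (hB : ThreeAPFree (S.B : Set (ZMod M))) {ω : VxxzSeed M N}
    {T : (Fin N → Fin (2 * c + 1)) × (Fin N → Fin (2 * c + 1)) × (Fin N → Fin (2 * c + 1))}
    (hT : T ∈ S.present ω) {A : Finset (Fin N → Fin c → Fin 3)} {Kh : Fin N → Fin c → Fin 3}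
    (hK : Kh ∈ S.holesZ ω T ∩ A) :
    ∃ T', (Kh, T') ∈ S.holePairsZIn A T ∧ InBucket (2 * c) ω T' (vxxzHashX ω (seqVal T.1)) := by
  obtain ⟨hK, hKA⟩ := mem_inter.1 hK
  rw [holesZ, mem_filter] at hK
  obtain ⟨-, hblk, hu, T', hT'p, hne, hK', hc⟩ := hK
  refine ⟨T', mem_filter.2 ⟨mem_product.2 ⟨hKA, xPresentTriples_subset hT'p⟩, hblk, hu, hne, hK', hc⟩, ?_⟩
  have hTb := h𝒯.inBucket_of_mem_hashPresent hM hB (hashPresent_of_mem_xPresentTriples hT)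
  have hT'b := h𝒯.inBucket_of_mem_hashPresent hM hB (hashPresent_of_mem_xPresentTriples hT'p)
  have e : vxxzHashX ω (seqVal T'.1) = vxxzHashX ω (seqVal T.1) := by
    rw [← hT'b.2.2, ← hTb.2.2, hK']
  rwa [e] at hT'b

/-- **Claim 5.20 / 6.21 summed, `Y`-holes**: over the seeds putting `T ∈ 𝒯α` into bucket `b` with `T ∈ 𝒯_hash`,
`∑_ω |holesY_ω T ∩ A_Y| ≤ U_Y(T) · M^{N−1}` (each pair contributes the `M^{N−1}` seeds of Lemma 6.7 (1), triples
sharing `Y_J`). [cite: AlmanDuanVassilevskaWilliamsXuXuZhou2025, Claims 5.20 / 6.21 and Lemma 6.7 (1)] -/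
theorem sum_card_holesYIn_le (hS : S.WellFormed) (h𝒯 : IsLevelFamily (2 * c) S.𝒯) (hM : M ≠ 2) (hcM : 2 * c < M) (hN : 0 < N)
    (hB : ThreeAPFree (S.B : Set (ZMod M))) (A : Finset (Fin N → Fin c → Fin 3))
    {T : (Fin N → Fin (2 * c + 1)) × (Fin N → Fin (2 * c + 1)) × (Fin N → Fin (2 * c + 1))} (hT : T ∈ S.𝒯α) (b : ZMod M) :
    ∑ ω ∈ univ.filter (fun ω : VxxzSeed M N => InBucket (2 * c) ω T b ∧ T ∈ S.present ω), (S.holesY ω T ∩ A).card ≤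
      (S.holePairsYIn A T).card * M ^ (N - 1) := by
  have hT𝒯 : T ∈ S.𝒯 := hS.subset hT
  have step1 : ∀ ω : VxxzSeed M N, InBucket (2 * c) ω T b → T ∈ S.present ω →
      (S.holesY ω T ∩ A).card ≤ ((S.holePairsYIn A T).filter fun p => InBucket (2 * c) ω T b ∧ InBucket (2 * c) ω p.2 b).card := by
    intro ω hb hp
    refine Finset.card_le_card_of_surjOn Prod.fst fun Jh hJh => ?_
    obtain ⟨T', hp', hb'⟩ := holeY_subset h𝒯 hM hB hp (mem_coe.1 hJh)
    refine ⟨(Jh, T'), mem_coe.2 (mem_filter.2 ⟨hp', hb, ?_⟩), rfl⟩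
    rwa [hb.1] at hb'
  calc ∑ ω ∈ univ.filter (fun ω : VxxzSeed M N => InBucket (2 * c) ω T b ∧ T ∈ S.present ω), (S.holesY ω T ∩ A).card
      ≤ ∑ ω ∈ univ.filter (fun ω : VxxzSeed M N => InBucket (2 * c) ω T b ∧ T ∈ S.present ω),
          ((S.holePairsYIn A T).filter fun p => InBucket (2 * c) ω T b ∧ InBucket (2 * c) ω p.2 b).card :=
        sum_le_sum fun ω hω => step1 ω (mem_filter.1 hω).2.1 (mem_filter.1 hω).2.2
    _ ≤ ∑ ω : VxxzSeed M N, ((S.holePairsYIn A T).filter fun p => InBucket (2 * c) ω T b ∧ InBucket (2 * c) ω p.2 b).card :=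
        sum_le_sum_of_subset_of_nonneg (filter_subset _ _) fun _ _ _ => Nat.zero_le _
    _ = ∑ p ∈ S.holePairsYIn A T, (univ.filter fun ω : VxxzSeed M N => InBucket (2 * c) ω T b ∧ InBucket (2 * c) ω p.2 b).card := by
        simp only [card_filter]
        rw [sum_comm]
    _ = ∑ _p ∈ S.holePairsYIn A T, M ^ (N - 1) := by
        refine sum_congr rfl fun p hp => ?_
        obtain ⟨hp𝒯, -, -, hne, h2, -⟩ := mem_filter.1 hp
        exact h𝒯.card_seeds_inBucket_shareY hM hcM hN hT𝒯 (hS.subset (mem_product.1 hp𝒯).2) hne h2 b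
    _ = (S.holePairsYIn A T).card * M ^ (N - 1) := by rw [sum_const, smul_eq_mul]

/-- **Claim 5.20 / 6.21 summed, `Z`-holes**: `∑_ω |holesZ_ω T ∩ A_Z| ≤ U_Z(T) · M^{N−1}`.
[cite: AlmanDuanVassilevskaWilliamsXuXuZhou2025, Claims 5.20 / 6.21 and Lemma 6.7 (1)] -/
theorem sum_card_holesZIn_le (hS : S.WellFormed) (h𝒯 : IsLevelFamily (2 * c) S.𝒯) (hM : M ≠ 2) (hcM : 2 * c < M) (hN : 0 < N)
    (hB : ThreeAPFree (S.B : Set (ZMod M))) (A : Finset (Fin N → Fin c → Fin 3))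
    {T : (Fin N → Fin (2 * c + 1)) × (Fin N → Fin (2 * c + 1)) × (Fin N → Fin (2 * c + 1))} (hT : T ∈ S.𝒯α) (b : ZMod M) :
    ∑ ω ∈ univ.filter (fun ω : VxxzSeed M N => InBucket (2 * c) ω T b ∧ T ∈ S.present ω), (S.holesZ ω T ∩ A).card ≤
      (S.holePairsZIn A T).card * M ^ (N - 1) := by
  have hT𝒯 : T ∈ S.𝒯 := hS.subset hT
  have step1 : ∀ ω : VxxzSeed M N, InBucket (2 * c) ω T b → T ∈ S.present ω →
      (S.holesZ ω T ∩ A).card ≤ ((S.holePairsZIn A T).filter fun p => InBucket (2 * c) ω T b ∧ InBucket (2 * c) ω p.2 b).card := by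
    intro ω hb hp
    refine Finset.card_le_card_of_surjOn Prod.fst fun Kh hKh => ?_
    obtain ⟨T', hp', hb'⟩ := holeZ_subset h𝒯 hM hB hp (mem_coe.1 hKh)
    refine ⟨(Kh, T'), mem_coe.2 (mem_filter.2 ⟨hp', hb, ?_⟩), rfl⟩
    rwa [hb.1] at hb'
  calc ∑ ω ∈ univ.filter (fun ω : VxxzSeed M N => InBucket (2 * c) ω T b ∧ T ∈ S.present ω), (S.holesZ ω T ∩ A).card
      ≤ ∑ ω ∈ univ.filter (fun ω : VxxzSeed M N => InBucket (2 * c) ω T b ∧ T ∈ S.present ω),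
          ((S.holePairsZIn A T).filter fun p => InBucket (2 * c) ω T b ∧ InBucket (2 * c) ω p.2 b).card :=
        sum_le_sum fun ω hω => step1 ω (mem_filter.1 hω).2.1 (mem_filter.1 hω).2.2
    _ ≤ ∑ ω : VxxzSeed M N, ((S.holePairsZIn A T).filter fun p => InBucket (2 * c) ω T b ∧ InBucket (2 * c) ω p.2 b).card :=
        sum_le_sum_of_subset_of_nonneg (filter_subset _ _) fun _ _ _ => Nat.zero_le _
    _ = ∑ p ∈ S.holePairsZIn A T, (univ.filter fun ω : VxxzSeed M N => InBucket (2 * c) ω T b ∧ InBucket (2 * c) ω p.2 b).card := by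
        simp only [card_filter]
        rw [sum_comm]
    _ = ∑ _p ∈ S.holePairsZIn A T, M ^ (N - 1) := by
        refine sum_congr rfl fun p hp => ?_
        obtain ⟨hp𝒯, -, -, hne, h3, -⟩ := mem_filter.1 hp
        exact HashedZeroOut.card_seeds_inBucket_shareZ (S := S.toHashedZeroOut) h𝒯 hM hcM hN hT𝒯
          (hS.subset (mem_product.1 hp𝒯).2) hne h3 b
    _ = (S.holePairsZIn A T).card * M ^ (N - 1) := by rw [sum_const, smul_eq_mul]

/-- **Markov's inequality for the relevant `Y`-holes** (threshold `h+1`). [cite: AlmanDuanVassilevskaWilliamsXuXuZhou2025, §5.5 / §6.5 ("By Markov's inequality")] -/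
theorem card_seeds_manyHolesYIn_mul_succ_le (hS : S.WellFormed) (h𝒯 : IsLevelFamily (2 * c) S.𝒯) (hM : M ≠ 2) (hcM : 2 * c < M)
    (hN : 0 < N) (hB : ThreeAPFree (S.B : Set (ZMod M))) (A : Finset (Fin N → Fin c → Fin 3))
    {T : (Fin N → Fin (2 * c + 1)) × (Fin N → Fin (2 * c + 1)) × (Fin N → Fin (2 * c + 1))} (hT : T ∈ S.𝒯α) (b : ZMod M) (h : ℕ) :
    (univ.filter fun ω : VxxzSeed M N =>
        InBucket (2 * c) ω T b ∧ T ∈ S.present ω ∧ h < (S.holesY ω T ∩ A).card).card * (h + 1) ≤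
      (S.holePairsYIn A T).card * M ^ (N - 1) := by
  calc (univ.filter fun ω : VxxzSeed M N =>
          InBucket (2 * c) ω T b ∧ T ∈ S.present ω ∧ h < (S.holesY ω T ∩ A).card).card * (h + 1)
      = ∑ _ω ∈ univ.filter (fun ω : VxxzSeed M N =>
          InBucket (2 * c) ω T b ∧ T ∈ S.present ω ∧ h < (S.holesY ω T ∩ A).card), (h + 1) := by
        rw [sum_const, smul_eq_mul]
    _ ≤ ∑ ω ∈ univ.filter (fun ω : VxxzSeed M N =>
          InBucket (2 * c) ω T b ∧ T ∈ S.present ω ∧ h < (S.holesY ω T ∩ A).card), (S.holesY ω T ∩ A).card :=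
        sum_le_sum fun ω hω => Nat.succ_le_of_lt (mem_filter.1 hω).2.2.2
    _ ≤ ∑ ω ∈ univ.filter (fun ω : VxxzSeed M N => InBucket (2 * c) ω T b ∧ T ∈ S.present ω), (S.holesY ω T ∩ A).card := by
        refine sum_le_sum_of_subset_of_nonneg (fun ω hω => ?_) fun _ _ _ => Nat.zero_le _
        have h' := mem_filter.1 hω
        exact mem_filter.2 ⟨h'.1, h'.2.1, h'.2.2.1⟩
    _ ≤ (S.holePairsYIn A T).card * M ^ (N - 1) := sum_card_holesYIn_le hS h𝒯 hM hcM hN hB A hT b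

/-- **Markov's inequality for the relevant `Z`-holes** (threshold `h+1`). [cite: AlmanDuanVassilevskaWilliamsXuXuZhou2025, §5.5 / §6.5] -/
theorem card_seeds_manyHolesZIn_mul_succ_le (hS : S.WellFormed) (h𝒯 : IsLevelFamily (2 * c) S.𝒯) (hM : M ≠ 2) (hcM : 2 * c < M)
    (hN : 0 < N) (hB : ThreeAPFree (S.B : Set (ZMod M))) (A : Finset (Fin N → Fin c → Fin 3))
    {T : (Fin N → Fin (2 * c + 1)) × (Fin N → Fin (2 * c + 1)) × (Fin N → Fin (2 * c + 1))} (hT : T ∈ S.𝒯α) (b : ZMod M) (h : ℕ) :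
    (univ.filter fun ω : VxxzSeed M N =>
        InBucket (2 * c) ω T b ∧ T ∈ S.present ω ∧ h < (S.holesZ ω T ∩ A).card).card * (h + 1) ≤
      (S.holePairsZIn A T).card * M ^ (N - 1) := by
  calc (univ.filter fun ω : VxxzSeed M N =>
          InBucket (2 * c) ω T b ∧ T ∈ S.present ω ∧ h < (S.holesZ ω T ∩ A).card).card * (h + 1)
      = ∑ _ω ∈ univ.filter (fun ω : VxxzSeed M N =>
          InBucket (2 * c) ω T b ∧ T ∈ S.present ω ∧ h < (S.holesZ ω T ∩ A).card), (h + 1) := by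
        rw [sum_const, smul_eq_mul]
    _ ≤ ∑ ω ∈ univ.filter (fun ω : VxxzSeed M N =>
          InBucket (2 * c) ω T b ∧ T ∈ S.present ω ∧ h < (S.holesZ ω T ∩ A).card), (S.holesZ ω T ∩ A).card :=
        sum_le_sum fun ω hω => Nat.succ_le_of_lt (mem_filter.1 hω).2.2.2
    _ ≤ ∑ ω ∈ univ.filter (fun ω : VxxzSeed M N => InBucket (2 * c) ω T b ∧ T ∈ S.present ω), (S.holesZ ω T ∩ A).card := by
        refine sum_le_sum_of_subset_of_nonneg (fun ω hω => ?_) fun _ _ _ => Nat.zero_le _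
        have h' := mem_filter.1 hω
        exact mem_filter.2 ⟨h'.1, h'.2.1, h'.2.2.1⟩
    _ ≤ (S.holePairsZIn A T).card * M ^ (N - 1) := sum_card_holesZIn_le hS h𝒯 hM hcM hN hB A hT b

/-- **The good seeds of a bucket**: under the degree bound of the cleanup (`8 deg_X ≤ M` on `𝒯α`) and the
final constraints `10 · U_Y(T) · M^{N−1} ≤ (h_Y+1) · M^N`, `10 · U_Z(T) · M^{N−1} ≤ (h_Z+1) · M^N`, at least half
of the `M^N` seeds putting `T ∈ 𝒯α` into the bucket `b ∈ B` make `T` a triple of `𝒯_hash` with at most `h_Y`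
relevant `Y`-holes and at most `h_Z` relevant `Z`-holes (`7/8 − 1/10 − 1/10 ≥ 1/2`).
[cite: AlmanDuanVassilevskaWilliamsXuXuZhou2025, §5.5 and §6.5–§6.6 ("with constant probability")] -/
theorem card_seeds_goodIn_ge (hS : S.WellFormed) (h𝒯 : IsLevelFamily (2 * c) S.𝒯) (hM : M ≠ 2) (hcM : 2 * c < M) (hN : 0 < N)
    (hB : ThreeAPFree (S.B : Set (ZMod M)))
    (hdegX : ∀ T ∈ S.𝒯α, 8 * (S.𝒯.filter fun T' => T'.1 = T.1).card ≤ M) (AY AZ : Finset (Fin N → Fin c → Fin 3))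
    {T : (Fin N → Fin (2 * c + 1)) × (Fin N → Fin (2 * c + 1)) × (Fin N → Fin (2 * c + 1))} (hT : T ∈ S.𝒯α)
    {b : ZMod M} (hb : b ∈ S.B) {hY hZ : ℕ}
    (hUY : 10 * ((S.holePairsYIn AY T).card * M ^ (N - 1)) ≤ (hY + 1) * M ^ N)
    (hUZ : 10 * ((S.holePairsZIn AZ T).card * M ^ (N - 1)) ≤ (hZ + 1) * M ^ N) :
    M ^ N ≤ 2 * (univ.filter fun ω : VxxzSeed M N =>
      T ∈ S.present ω ∧ InBucket (2 * c) ω T b ∧ (S.holesY ω T ∩ AY).card ≤ hY ∧ (S.holesZ ω T ∩ AZ).card ≤ hZ).card := by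
  have hT𝒯 : T ∈ S.𝒯 := hS.subset hT
  have h67 := advxxz2025_lemma67_survival h𝒯 hM hcM hN hT𝒯 (hdegX T hT) b
  set Sv := univ.filter fun ω : VxxzSeed M N => XSurvives S.𝒯 ω T b with hSv
  set good := univ.filter fun ω : VxxzSeed M N =>
    T ∈ S.present ω ∧ InBucket (2 * c) ω T b ∧ (S.holesY ω T ∩ AY).card ≤ hY ∧ (S.holesZ ω T ∩ AZ).card ≤ hZ with hgood
  set badY := univ.filter fun ω : VxxzSeed M N =>
    InBucket (2 * c) ω T b ∧ T ∈ S.present ω ∧ hY < (S.holesY ω T ∩ AY).card with hbadY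
  set badZ := univ.filter fun ω : VxxzSeed M N =>
    InBucket (2 * c) ω T b ∧ T ∈ S.present ω ∧ hZ < (S.holesZ ω T ∩ AZ).card with hbadZ
  have hcover : Sv ⊆ good ∪ (badY ∪ badZ) := by
    intro ω hω
    rw [hSv, mem_filter] at hω
    have hpres : T ∈ S.present ω := by
      rw [present, h𝒯.xPresentTriples_eq_filter_xSurvives hM hS.subset ω hB, mem_filter]
      exact ⟨hT, b, hb, hω.2⟩
    have hin : InBucket (2 * c) ω T b := hω.2.1
    rw [mem_union, mem_union, hgood, hbadY, hbadZ, mem_filter, mem_filter, mem_filter]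
    by_cases hleY : (S.holesY ω T ∩ AY).card ≤ hY
    · by_cases hleZ : (S.holesZ ω T ∩ AZ).card ≤ hZ
      · exact Or.inl ⟨mem_univ _, hpres, hin, hleY, hleZ⟩
      · exact Or.inr (Or.inr ⟨mem_univ _, hin, hpres, Nat.lt_of_not_le hleZ⟩)
    · exact Or.inr (Or.inl ⟨mem_univ _, hin, hpres, Nat.lt_of_not_le hleY⟩)
  have hSv_le : Sv.card ≤ good.card + (badY.card + badZ.card) :=
    (card_le_card hcover).trans ((card_union_le _ _).trans (Nat.add_le_add_left (card_union_le _ _) _))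
  have hbadY_le : 10 * badY.card ≤ M ^ N := by
    have hm := card_seeds_manyHolesYIn_mul_succ_le hS h𝒯 hM hcM hN hB AY hT b hY
    have : 10 * badY.card * (hY + 1) ≤ (hY + 1) * M ^ N := by
      calc 10 * badY.card * (hY + 1) = 10 * (badY.card * (hY + 1)) := by ring
        _ ≤ 10 * ((S.holePairsYIn AY T).card * M ^ (N - 1)) := Nat.mul_le_mul_left _ hm
        _ ≤ (hY + 1) * M ^ N := hUY
    rw [mul_comm (hY + 1)] at this
    exact Nat.le_of_mul_le_mul_right this (Nat.succ_pos hY)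
  have hbadZ_le : 10 * badZ.card ≤ M ^ N := by
    have hm := card_seeds_manyHolesZIn_mul_succ_le hS h𝒯 hM hcM hN hB AZ hT b hZ
    have : 10 * badZ.card * (hZ + 1) ≤ (hZ + 1) * M ^ N := by
      calc 10 * badZ.card * (hZ + 1) = 10 * (badZ.card * (hZ + 1)) := by ring
        _ ≤ 10 * ((S.holePairsZIn AZ T).card * M ^ (N - 1)) := Nat.mul_le_mul_left _ hm
        _ ≤ (hZ + 1) * M ^ N := hUZ
    rw [mul_comm (hZ + 1)] at this
    exact Nat.le_of_mul_le_mul_right this (Nat.succ_pos hZ)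
  omega

/-- For a fixed seed, the good pairs `(b, T)`, `b ∈ B`, are counted by the good triples of `𝒯_hash` (the bucket of a
triple of `𝒯_hash` is `h_X(I) ∈ B`). [cite: AlmanDuanVassilevskaWilliamsXuXuZhou2025, §5.2 / §6.2 (buckets)] -/
theorem card_filter_product_goodIn_eq (h𝒯 : IsLevelFamily (2 * c) S.𝒯) (hM : M ≠ 2) (hB : ThreeAPFree (S.B : Set (ZMod M)))
    (hsub : S.𝒯α ⊆ S.𝒯) (AY AZ : Finset (Fin N → Fin c → Fin 3)) (ω : VxxzSeed M N) (hY hZ : ℕ) :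
    ((S.B ×ˢ S.𝒯α).filter fun bT => bT.2 ∈ S.present ω ∧ InBucket (2 * c) ω bT.2 bT.1 ∧
        (S.holesY ω bT.2 ∩ AY).card ≤ hY ∧ (S.holesZ ω bT.2 ∩ AZ).card ≤ hZ).card =
      ((S.present ω).filter fun T => (S.holesY ω T ∩ AY).card ≤ hY ∧ (S.holesZ ω T ∩ AZ).card ≤ hZ).card := by
  refine card_bij (fun bT _ => bT.2) (fun bT hbT => ?_) (fun bT₁ h₁ bT₂ h₂ heq => ?_) (fun T hT => ?_)
  · rw [mem_filter] at hbT
    exact mem_filter.2 ⟨hbT.2.1, hbT.2.2.2⟩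
  · rw [mem_filter] at h₁ h₂
    have e : bT₁.1 = bT₂.1 := by
      have e1 := h₁.2.2.1.1
      have e2 := h₂.2.2.1.1
      rw [heq] at e1
      exact e1.symm.trans e2
    exact Prod.ext e heq
  · rw [mem_filter] at hT
    obtain ⟨hTp, hle⟩ := hT
    have hTα : T ∈ S.𝒯α := xPresentTriples_subset hTp
    have hsurv : ∃ b ∈ S.B, XSurvives S.𝒯 ω T b := by
      have := hTp
      rw [present, h𝒯.xPresentTriples_eq_filter_xSurvives hM hsub ω hB, mem_filter] at this
      exact this.2
    obtain ⟨b, hb, hs⟩ := hsurv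
    exact ⟨(b, T), mem_filter.2 ⟨mem_product.2 ⟨hb, hTα⟩, hTp, hs.1, hle⟩, rfl⟩

/-- **Existence of a good seed** (§5.5 / §6.5–§6.6, exact form): under the hypotheses of `card_seeds_goodIn_ge`
for every `T ∈ 𝒯α`, some seed makes at least `|B| |𝒯α| / (2M²)` triples of `𝒯_hash` good:
`|B| |𝒯α| ≤ 2 M² · #{T ∈ 𝒯_hash(ω) | |holesY_ω T ∩ A_Y| ≤ h_Y ∧ |holesZ_ω T ∩ A_Z| ≤ h_Z}`.
[cite: AlmanDuanVassilevskaWilliamsXuXuZhou2025, §5.5 (last paragraph) and §6.5–§6.6] -/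
theorem exists_seed_many_goodIn_copies (hS : S.WellFormed) (h𝒯 : IsLevelFamily (2 * c) S.𝒯) (hM : M ≠ 2) (hcM : 2 * c < M)
    (hN : 0 < N) (hB : ThreeAPFree (S.B : Set (ZMod M)))
    (hdegX : ∀ T ∈ S.𝒯α, 8 * (S.𝒯.filter fun T' => T'.1 = T.1).card ≤ M) (AY AZ : Finset (Fin N → Fin c → Fin 3)) {hY hZ : ℕ}
    (hUY : ∀ T ∈ S.𝒯α, 10 * ((S.holePairsYIn AY T).card * M ^ (N - 1)) ≤ (hY + 1) * M ^ N)
    (hUZ : ∀ T ∈ S.𝒯α, 10 * ((S.holePairsZIn AZ T).card * M ^ (N - 1)) ≤ (hZ + 1) * M ^ N) :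
    ∃ ω : VxxzSeed M N, S.B.card * S.𝒯α.card ≤ 2 * M ^ 2 *
      ((S.present ω).filter fun T => (S.holesY ω T ∩ AY).card ≤ hY ∧ (S.holesZ ω T ∩ AZ).card ≤ hZ).card := by
  have hsum : S.B.card * S.𝒯α.card * M ^ N ≤ 2 * ∑ ω : VxxzSeed M N,
      ((S.present ω).filter fun T => (S.holesY ω T ∩ AY).card ≤ hY ∧ (S.holesZ ω T ∩ AZ).card ≤ hZ).card := by
    have hswap : ∑ ω : VxxzSeed M N, ((S.B ×ˢ S.𝒯α).filter fun bT =>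
        bT.2 ∈ S.present ω ∧ InBucket (2 * c) ω bT.2 bT.1 ∧
          (S.holesY ω bT.2 ∩ AY).card ≤ hY ∧ (S.holesZ ω bT.2 ∩ AZ).card ≤ hZ).card =
        ∑ bT ∈ S.B ×ˢ S.𝒯α, (univ.filter fun ω : VxxzSeed M N =>
          bT.2 ∈ S.present ω ∧ InBucket (2 * c) ω bT.2 bT.1 ∧
            (S.holesY ω bT.2 ∩ AY).card ≤ hY ∧ (S.holesZ ω bT.2 ∩ AZ).card ≤ hZ).card := by
      simp only [card_filter]
      rw [sum_comm]
    calc S.B.card * S.𝒯α.card * M ^ N = ∑ _bT ∈ S.B ×ˢ S.𝒯α, M ^ N := by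
          rw [sum_const, card_product, smul_eq_mul]
      _ ≤ ∑ bT ∈ S.B ×ˢ S.𝒯α, 2 * (univ.filter fun ω : VxxzSeed M N =>
            bT.2 ∈ S.present ω ∧ InBucket (2 * c) ω bT.2 bT.1 ∧
              (S.holesY ω bT.2 ∩ AY).card ≤ hY ∧ (S.holesZ ω bT.2 ∩ AZ).card ≤ hZ).card :=
          sum_le_sum fun bT hbT => card_seeds_goodIn_ge hS h𝒯 hM hcM hN hB hdegX AY AZ (mem_product.1 hbT).2
            (mem_product.1 hbT).1 (hUY _ (mem_product.1 hbT).2) (hUZ _ (mem_product.1 hbT).2)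
      _ = 2 * ∑ ω : VxxzSeed M N, ((S.present ω).filter fun T =>
            (S.holesY ω T ∩ AY).card ≤ hY ∧ (S.holesZ ω T ∩ AZ).card ≤ hZ).card := by
          rw [← mul_sum, ← hswap]
          congr 1
          exact sum_congr rfl fun ω _ => card_filter_product_goodIn_eq h𝒯 hM hB hS.subset AY AZ ω hY hZ
  by_contra hcon
  simp only [not_exists, not_le] at hcon
  have hlt : ∑ ω : VxxzSeed M N, 2 * M ^ 2 * ((S.present ω).filter fun T =>
      (S.holesY ω T ∩ AY).card ≤ hY ∧ (S.holesZ ω T ∩ AZ).card ≤ hZ).card <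
      ∑ _ω : VxxzSeed M N, S.B.card * S.𝒯α.card :=
    sum_lt_sum_of_nonempty univ_nonempty fun ω _ => hcon ω
  rw [sum_const, card_univ, card_vxxzSeed, smul_eq_mul, ← mul_sum] at hlt
  have : M ^ (N + 2) * (S.B.card * S.𝒯α.card) ≤
      2 * M ^ 2 * ∑ ω : VxxzSeed M N, ((S.present ω).filter fun T =>
        (S.holesY ω T ∩ AY).card ≤ hY ∧ (S.holesZ ω T ∩ AZ).card ≤ hZ).card := by
    calc M ^ (N + 2) * (S.B.card * S.𝒯α.card) = M ^ 2 * (S.B.card * S.𝒯α.card * M ^ N) := by ring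
      _ ≤ M ^ 2 * (2 * ∑ ω : VxxzSeed M N, ((S.present ω).filter fun T =>
          (S.holesY ω T ∩ AY).card ≤ hY ∧ (S.holesZ ω T ∩ AZ).card ≤ hZ).card) := Nat.mul_le_mul_left _ hsum
      _ = _ := by ring
  exact absurd (lt_of_le_of_lt this hlt) (lt_irrefl _)

end MoreAsymHashedZeroOut

end Literature.Computability.AlgebraicComplexity
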